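import Summits.CriticalPhenomena.SAWScalingLimit.Theses.SAWDefectDecoherence
import Summits.CriticalPhenomena.SAWScalingLimit.Theses.SAWPhaseRetrieval
import Summits.CriticalPhenomena.SAWScalingLimit.Theses.SAWWindingAlias
import Summits.CriticalPhenomena.SAWScalingLimit.Theses.SAWDevelopingMap
import Summits.CriticalPhenomena.SAWScalingLimit.Theses.SAWResidueField
import Summits.CriticalPhenomena.SAWScalingLimit.Theorems.SAWMassiveIsingTiltHexEndpointApproxExists
import Literature.Probability.RandomPlanarGeometry.SLEUniquenessInLaw

/-!
# The crux `HexTransfer` is `HexSAWScalingLimit → LatticeUniversality`, unconditionally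

Crux stmt-CriticalPhenomena-14221, `Theses.SAWPhaseRetrieval.HexTransfer` (identical bodies in
`SAWDefectDecoherence`, `SAWWindingAlias`, `SAWDevelopingMap`):
`(Duminil-Copin–Smirnov 2012 Conjecture 1 on the hexagonal lattice, written out; "(A)") → SAWScalingLimit`.

This file records, sorry-free and WITHOUT any open hypothesis, where the crux sits:

* `hexTransfer_of_latticeUniversality` — the two-ε argument: lattice universality of the critical
  chordal SAW law (`SAWResidueField.LatticeUniversality`, item stmt-CriticalPhenomena-0807) implies the
  crux outright. The hexagonal endpoint approximation it needs exists in every Dobrushin domain by the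
  landed `HexEndpointApprox.exists_isEmbEndpointApprox` (item 9864), so no hypothesis remains.
* `latticeUniversality_of_hexTransfer`, `hexTransfer_iff_latticeUniversality` — under (A) the crux is
  EQUIVALENT to item 0807 (the `→` direction is the positive form of the crux disprover's rigidity theorem
  `Negative.not_hexTransfer_of_not_latticeUniversality`, p95732: two chordal SLE(8/3) random curves of one
  Dobrushin domain are equal in law, `IsSLECurve.map_eq_holds`).
* `hexTransfer_iff_imp` — hence, with no hypothesis at all,
  `HexTransfer ↔ (HexSAWScalingLimit → LatticeUniversality)`: the implicational form buys nothing over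
  lattice universality where it has content, and is implied by it everywhere.
* the same three statements for the sibling copies of the crux.

Consequence for staffing (line lead, third seat, 2026-08-16): every line on this crux
(`Lines/pin_the_shear.lean`, `Lines/Sketch.lean`, `Lines/dodecagonal_pivot.lean`) is reduced in the
tree to stubs of open-problem size; the crux itself is blocked on the existing item
stmt-CriticalPhenomena-0807 (or, through line `Sketch`, on stmt-6967 ∧ stmt-6964), kernel-checked here.
-/

noncomputable section

namespace Summit.CriticalPhenomena.SAWScalingLimit.Cruxes.HexTransfer.Sandwich

open MeasureTheory Filter Topology
open Literature.Probability.LatticeModels Literature.Probability.RandomPlanarGeometry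
open Literature.Probability.RandomPlanarGeometry.SAW
open Summit.CriticalPhenomena.SAWScalingLimit.Theses
open Summit.CriticalPhenomena.SAWScalingLimit.Theorems.HexEndpointApprox (exists_isEmbEndpointApprox)
open scoped NNReal ENNReal BoundedContinuousFunction

/-! ### Hexagonal endpoint approximations (item 9864, landed) in route `SAWResidueField`'s spelling -/

/-- Route `SAWResidueField`'s copy of `HexEndpointApproxExists` (item stmt-CriticalPhenomena-9864) holds:
every Dobrushin domain admits a hexagonal endpoint approximation
(`HexEndpointApprox.exists_isEmbEndpointApprox`; the `δℤ²` approximation in the hypothesis is not used).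
[folklore] -/
theorem hexEndpointApproxExists : SAWResidueField.HexEndpointApproxExists :=
  fun D _ _ _ => exists_isEmbEndpointApprox D

/-! ### The two-ε argument: lattice universality implies the crux -/

/-- **`LatticeUniversality → HexTransfer`** (the two-ε argument, unconditional). Given (A) and a `δℤ²`
endpoint approximation `(a, b)` of the Dobrushin domain `D`, pick a hexagonal endpoint approximation
`(a', b')` of `D` (it exists, item 9864); (A) gives a chordal SLE(8/3) random curve `Γ` of `D` with
`∫ f dP^{Hex}_δ → E f(Γ)`; lattice universality gives `∫ f dP^{ℤ²}_δ - ∫ f dP^{Hex}_δ → 0`; add.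
Measurability of `γ ↦ γ.curve` is automatic (discrete σ-algebra). [folklore] -/
theorem hexTransfer_of_latticeUniversality :
    SAWResidueField.LatticeUniversality → SAWPhaseRetrieval.HexTransfer := by
  intro hU hA D a b hab
  obtain ⟨a', b', hab'⟩ := exists_isEmbEndpointApprox D
  obtain ⟨Γ, hΓ, -, hT⟩ := hA D a' b' hab'
  refine ⟨Γ, hΓ, Eventually.of_forall fun δ => aemeasurable_curve D.carrier δ (a δ) (b δ), fun f => ?_⟩
  have h := (hU D a b a' b' hab hab' f).add (hT f)
  rw [zero_add] at h
  exact h.congr fun δ => sub_add_cancel _ _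

/-- **Rigidity, positive form**: under (A), the crux gives lattice universality of the critical chordal
SAW law for EVERY pairing of a `δℤ²` endpoint approximation with a hexagonal one — the `δℤ²` limit (from
the crux) and the hexagonal limit (from (A)) are chordal SLE(8/3) random curves of the same Dobrushin
domain, hence equal in law (`IsSLECurve.map_eq_holds`), so the two test integrals have the same limit
(the disprover's `Negative/RefutationCost.lean`, p95732, states this direction negatively; it is not
imported, to keep this positive-side file independent of the `Negative/` tree). [folklore] -/
theorem latticeUniversality_of_hexTransfer (hA : HexSAWScalingLimit) (hTr : SAWPhaseRetrieval.HexTransfer) :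
    SAWResidueField.LatticeUniversality := by
  intro D a b a' b' hab hab' f
  obtain ⟨Γ, hΓ, -, hT⟩ := hTr hA D a b hab
  obtain ⟨Γ', hΓ', -, hT'⟩ := hA D a' b' hab'
  -- the two limits have the same law, hence the same integral of `f`
  have hint : ∫ ω, f (Γ ω) ∂Literature.Probability.Process.preWienerMeasure =
      ∫ ω, f (Γ' ω) ∂Literature.Probability.Process.preWienerMeasure := by
    rw [← integral_map hΓ.1 f.continuous.aestronglyMeasurable,
      ← integral_map hΓ'.1 f.continuous.aestronglyMeasurable, IsSLECurve.map_eq_holds hΓ hΓ']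
  have h := (hT f).sub (hT' f)
  rwa [hint, sub_self] at h

/-- **Under (A), the crux is item stmt-0807**: `HexTransfer ↔ LatticeUniversality`. [folklore] -/
theorem hexTransfer_iff_latticeUniversality (hA : HexSAWScalingLimit) :
    SAWPhaseRetrieval.HexTransfer ↔ SAWResidueField.LatticeUniversality :=
  ⟨latticeUniversality_of_hexTransfer hA, fun hU => hexTransfer_of_latticeUniversality hU⟩

/-- **What the crux is, with no hypothesis**: `HexTransfer ↔ (HexSAWScalingLimit → LatticeUniversality)`.
[folklore] -/
theorem hexTransfer_iff_imp :
    SAWPhaseRetrieval.HexTransfer ↔ (HexSAWScalingLimit → SAWResidueField.LatticeUniversality) :=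
  ⟨fun h hA => (hexTransfer_iff_latticeUniversality hA).1 h,
    fun h hA => hexTransfer_of_latticeUniversality (h hA) hA⟩

/-- The antecedent of the crux is non-vacuously typed: its endpoint hypothesis is met in every Dobrushin
domain, so under (A) every Dobrushin domain carries a chordal SLE(8/3) random curve. [folklore] -/
theorem exists_isSLECurve_of_antecedent (hA : HexSAWScalingLimit) (D : DobrushinDomain) :
    ∃ Γ, IsSLECurve ((8 : ℝ≥0) / 3) D Γ := by
  obtain ⟨a', b', hab'⟩ := exists_isEmbEndpointApprox D
  obtain ⟨Γ, hΓ, -, -⟩ := hA D a' b' hab'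
  exact ⟨Γ, hΓ⟩

/-! ### The sibling copies of the crux -/

/-- `LatticeUniversality → HexTransfer`, route `SAWDefectDecoherence`'s copy. [folklore] -/
theorem hexTransfer_defectDecoherence_of_latticeUniversality (hU : SAWResidueField.LatticeUniversality) :
    SAWDefectDecoherence.HexTransfer :=
  hexTransfer_of_latticeUniversality hU

/-- `LatticeUniversality → HexTransfer`, route `SAWWindingAlias`'s copy. [folklore] -/
theorem hexTransfer_windingAlias_of_latticeUniversality (hU : SAWResidueField.LatticeUniversality) :
    SAWWindingAlias.HexTransfer :=
  hexTransfer_of_latticeUniversality hU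

/-- `LatticeUniversality → HexTransfer`, route `SAWDevelopingMap`'s copy. [folklore] -/
theorem hexTransfer_developingMap_of_latticeUniversality (hU : SAWResidueField.LatticeUniversality) :
    SAWDevelopingMap.HexTransfer :=
  hexTransfer_of_latticeUniversality hU

/-- `HexTransfer ↔ (HexSAWScalingLimit → LatticeUniversality)`, route `SAWDefectDecoherence`'s copy.
[folklore] -/
theorem hexTransfer_defectDecoherence_iff_imp :
    SAWDefectDecoherence.HexTransfer ↔ (HexSAWScalingLimit → SAWResidueField.LatticeUniversality) :=
  hexTransfer_iff_imp

/-- `HexTransfer ↔ (HexSAWScalingLimit → LatticeUniversality)`, route `SAWWindingAlias`'s copy.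
[folklore] -/
theorem hexTransfer_windingAlias_iff_imp :
    SAWWindingAlias.HexTransfer ↔ (HexSAWScalingLimit → SAWResidueField.LatticeUniversality) :=
  hexTransfer_iff_imp

/-- `HexTransfer ↔ (HexSAWScalingLimit → LatticeUniversality)`, route `SAWDevelopingMap`'s copy.
[folklore] -/
theorem hexTransfer_developingMap_iff_imp :
    SAWDevelopingMap.HexTransfer ↔ (HexSAWScalingLimit → SAWResidueField.LatticeUniversality) :=
  hexTransfer_iff_imp

end Summit.CriticalPhenomena.SAWScalingLimit.Cruxes.HexTransfer.Sandwich

end
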